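import Summits.HodgeConjecture.CorCM.GaloisTwentyFourDegenerateModels
import HarnessLib

/-!
# Mirror CM types of dihedral Galois groups: a CM half of `⟨r⟩` and its reflected copy on the sheet of reflections —
# balanced (degenerate) by the symmetry of the autocorrelation, primitive iff the half is aperiodic and asymmetric

COR-CM (cell `pub-hodgecm2`), binder seat b04 (gen 22), count-neutral claim GALOIS-DIHEDRAL, part I — the MECHANISM.
KERNEL ONLY: theorems; no definition, no named fact, no `sorry`.  `HC_CM` is neither used nor claimed.

SETTING.  `G₀ =` Mathlib `DihedralGroup m` (`r k`, `sr k`, `k ∈ ℤ/m`; `r i · r j = r (i+j)`, `r i · sr j = sr (j-i)`,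
`sr i · r j = sr (i+j)`, `sr i · sr j = r (j-i)`), complex conjugation `c₀ = r h` central (`h + h = 0`).  For a finite
`S₁ ⊆ ℤ/m` which is a CM HALF for `h` (`k ∈ S₁ ⟺ h + k ∉ S₁`) and a parameter `t ∈ ℤ/m`, the MIRROR TYPE is
`T = {r k : k ∈ S₁} ⊔ {sr k : t − k ∈ S₁}` — the half `S₁` on the sheet of rotations and its REFLECTED copy `t − S₁` on
the sheet of reflections.  (In the two-sheet Fourier analysis of gen 20, `CorCM/TwoSheetAnnihilator`, the dihedral
presentation `x² = 1` gives the determinant `|Ŝ₁(χ)|² − |Ŝ₂(χ)|²` — `CorCM/DihedralThirtyTwoDegenerateModel`, docstring —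
and a reflected copy has `|Ŝ₂(χ)| = |Ŝ₁(χ)|` for EVERY character `χ` of `⟨r⟩`: all the odd `2 × 2` blocks are singular.)
This file proves the degeneracy WITHOUT Fourier analysis, by an explicit BALANCED SET in the certificate format of
gen 19/20 (`GaloisModels.exists_simple_degenerate_of_model_balanced`):
`D = {r k : k ∈ S₁} ⊔ {sr k : t − k ∉ S₁}` satisfies `2 · #{x ∈ D : x g ∈ T} = #D` for every `g ∈ G₀` (§2
`mirror_balanced`) — the one identity used is the symmetry `a(j) = a(−j)` of the AUTOCORRELATION
`a(j) = #{k ∈ S₁ : k + j ∈ S₁}` (§1 `card_autocorrelation_symm`) — and `c₀` moves a point of `D` off `D`; so `T` is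
DEGENERATE (Hazama's balanced-weight criterion, gen 19 `not_isNondegenerate_of_galois_balanced`).  Its LEFT STABILISER
is trivial iff `S₁` is APERIODIC (`j + S₁ ≠ S₁` for `j ≠ 0`: rules out `r j`) and ASYMMETRIC (`u − S₁ ≠ S₁` for all `u`:
rules out `sr j`, which would need `S₁ = (t − j) − S₁`) (§3 `mirror_leftStabiliser`).  Hence (§4
**`exists_simple_degenerate_of_mirror`**): a Galois CM field `K` with `e : Gal(K/ℚ) ≃* DihedralGroup m`, `e(c) = r h`,
and an aperiodic asymmetric CM half of `ℤ/m` for `h` carries a PRIMITIVE DEGENERATE CM type, i.e. a SIMPLE DEGENERATE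
abelian variety of dimension `m` with CM by `K` and an exceptional Hodge class on some power (Shimura's existence
theorem, Hazama's converse).  Part II (`CorCM/CyclicAsymmetricCMHalves`) supplies such halves of `ℤ/2n` for every
`n ≥ 6`; part III draws the conclusion for the dihedral groups of order `4n`, `n ≥ 5`.

## References

* [Shimura1998] G. Shimura, *Abelian Varieties with Complex Multiplication and Modular Functions*, §6.2 Thm. 3,
  §8.2 Prop. 26 (left stabiliser ⟺ imprimitive).
* [Gordon1999HodgeAVSurvey] B. B. Gordon, *A survey of the Hodge conjecture for abelian varieties*, Thm. 6.4, §9.3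
  (Hazama: balanced weights).
* [Kubota1965] T. Kubota, Trans. AMS 118 (1965), §2 (rank, nondegenerate ⟹ primitive).
* [Dodson1984] B. Dodson, *The structure of Galois groups of CM-fields*, Trans. AMS 283 (1984), §3.3.1 (C), §4.1
  (dihedral groups).
-/

noncomputable section

open CategoryTheory CategoryTheory.Limits NumberField
open scoped BigOperators

namespace Summit.HodgeConjecture.CorCM.GaloisDihedral

open Literature.NumberTheory.ComplexMultiplication
open Literature.AlgebraicGeometry.Motives (AbelianVariety CMType)
open Literature.AlgebraicGeometry.HodgeTheory
open Literature.AlgebraicGeometry.ComplexMultiplication (IsCMTypeRealisation)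
open Literature.AlgebraicGeometry.Pohlmann1968
open Literature.Barriers.HodgeConjecture (divisorClassesSpan)
open Summit.HodgeConjecture.CorCM.GaloisModels
open DihedralGroup

/-! ## §1 Counting on `ℤ/m`: shifts, reflections, the autocorrelation -/

section Counting

variable {m : ℕ} [NeZero m]

/-- Counting through a translation: `#{k : R (k + j)} = #{u : R u}`. [folklore] -/
theorem card_filter_add_right (R : ZMod m → Prop) [DecidablePred R] (j : ZMod m) :
    (Finset.univ.filter fun k => R (k + j)).card = (Finset.univ.filter R).card := by
  simp only [Finset.card_filter]
  exact Fintype.sum_equiv (Equiv.addRight j) _ _ fun _ => rfl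

/-- Counting through a reflection: `#{k : R (t - k)} = #{u : R u}`. [folklore] -/
theorem card_filter_sub_left (R : ZMod m → Prop) [DecidablePred R] (t : ZMod m) :
    (Finset.univ.filter fun k => R (t - k)).card = (Finset.univ.filter R).card := by
  simp only [Finset.card_filter]
  exact Fintype.sum_equiv (Equiv.subLeft t) _ _ fun _ => rfl

/-- **Symmetry of the autocorrelation**: `#{k ∈ S₁ : k + j ∈ S₁} = #{k ∈ S₁ : k - j ∈ S₁}` (`k ↦ k + j`). [folklore] -/
theorem card_autocorrelation_symm (S₁ : Finset (ZMod m)) (j : ZMod m) :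
    (Finset.univ.filter fun k => k ∈ S₁ ∧ k + j ∈ S₁).card =
      (Finset.univ.filter fun k => k ∈ S₁ ∧ k - j ∈ S₁).card := by
  rw [← card_filter_add_right (fun k => k ∈ S₁ ∧ k - j ∈ S₁) j]
  congr 1
  refine Finset.filter_congr fun k _ => ?_
  rw [add_sub_cancel_right, and_comm]

/-- `#{u ∉ S₁ : u + j ∈ S₁} + #{u ∈ S₁ : u + j ∈ S₁} = #S₁`. [folklore] -/
theorem card_filter_not_mem_add (S₁ : Finset (ZMod m)) (j : ZMod m) :
    (Finset.univ.filter fun u => u ∉ S₁ ∧ u + j ∈ S₁).card +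
      (Finset.univ.filter fun u => u ∈ S₁ ∧ u + j ∈ S₁).card = S₁.card := by
  have hs : (Finset.univ.filter fun u : ZMod m => u + j ∈ S₁).card = S₁.card := by
    rw [card_filter_add_right (fun u => u ∈ S₁) j, Finset.filter_univ_mem]
  rw [← hs, ← Finset.card_filter_add_card_filter_not
    (s := Finset.univ.filter fun u : ZMod m => u + j ∈ S₁) (fun u => u ∉ S₁), Finset.filter_filter,
    Finset.filter_filter]
  congr 2
  · exact Finset.filter_congr fun u _ => and_comm
  · exact Finset.filter_congr fun u _ => by rw [not_not, and_comm]

/-- **A CM half has `m/2` elements**: `k ∈ S₁ ⟺ h + k ∉ S₁` forces `2 · #S₁ = m`. [folklore] -/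
theorem two_mul_card_of_half (S₁ : Finset (ZMod m)) (h : ZMod m) (hS : ∀ k, k ∈ S₁ ↔ h + k ∉ S₁) :
    2 * S₁.card = m := by
  classical
  have himage : S₁ᶜ = S₁.image fun k => h + k := by
    ext u
    simp only [Finset.mem_compl, Finset.mem_image]
    constructor
    · intro hu
      refine ⟨u - h, ?_, by abel⟩
      rw [hS, add_sub_cancel]
      exact hu
    · rintro ⟨k, hk, rfl⟩
      exact (hS k).1 hk
  have h1 : S₁ᶜ.card = S₁.card := by
    rw [himage, Finset.card_image_of_injective _ (add_right_injective h)]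
  have h2 := Finset.card_compl S₁
  have h3 : S₁.card ≤ Fintype.card (ZMod m) := Finset.card_le_univ S₁
  rw [ZMod.card] at h2 h3
  omega

/-- Counting on the dihedral group sheet by sheet: `#{x : Q x} = #{k : Q (r k)} + #{k : Q (sr k)}`. [folklore] -/
theorem card_filter_dihedral (Q : DihedralGroup m → Prop) [DecidablePred Q] :
    (Finset.univ.filter Q).card =
      (Finset.univ.filter fun k : ZMod m => Q (r k)).card + (Finset.univ.filter fun k : ZMod m => Q (sr k)).card := by
  simp only [Finset.card_filter]
  rw [Fintype.sum_equiv equivSum _ (fun y => if Q (equivSum.symm y) then 1 else 0) fun x => by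
      rw [Equiv.symm_apply_apply],
    Fintype.sum_sum_type]
  rfl

end Counting

/-! ## §2 The mirror type: existence, CM property, the balanced set -/

section Mirror

variable {m : ℕ} {S₁ : Finset (ZMod m)} {t h : ZMod m} {T D : Finset (DihedralGroup m)}

/-- **The mirror type exists**: `r k ∈ T ↔ k ∈ S₁`, `sr k ∈ T ↔ t - k ∈ S₁`. [folklore] -/
theorem exists_mirror (S₁ : Finset (ZMod m)) (t : ZMod m) :
    ∃ T : Finset (DihedralGroup m), (∀ k, r k ∈ T ↔ k ∈ S₁) ∧ (∀ k, sr k ∈ T ↔ t - k ∈ S₁) := by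
  classical
  refine ⟨S₁.image r ∪ S₁.image fun k => sr (t - k), fun k => ?_, fun k => ?_⟩
  · simp
  · simp only [Finset.mem_union, Finset.mem_image, reduceCtorEq, and_false, exists_false, false_or, sr.injEq]
    constructor
    · rintro ⟨a, ha, rfl⟩
      rwa [sub_sub_cancel]
    · intro hk
      exact ⟨t - k, hk, sub_sub_cancel t k⟩

/-- **The companion set exists**: `r k ∈ D ↔ k ∈ S₁`, `sr k ∈ D ↔ t - k ∉ S₁`. [folklore] -/
theorem exists_comirror [NeZero m] (S₁ : Finset (ZMod m)) (t : ZMod m) :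
    ∃ D : Finset (DihedralGroup m), (∀ k, r k ∈ D ↔ k ∈ S₁) ∧ (∀ k, sr k ∈ D ↔ t - k ∉ S₁) := by
  classical
  refine ⟨S₁.image r ∪ (Finset.univ.filter fun k => t - k ∉ S₁).image sr, fun k => ?_, fun k => ?_⟩
  · simp
  · simp

/-- **The mirror type is a CM set for `c₀ = r h`**: `x ∈ T ↔ r h · x ∉ T`. [cite: Shimura1998, §18.2 Lemma (i)] -/
theorem mirror_mem_iff (hS : ∀ k, k ∈ S₁ ↔ h + k ∉ S₁) (hTr : ∀ k, r k ∈ T ↔ k ∈ S₁)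
    (hTs : ∀ k, sr k ∈ T ↔ t - k ∈ S₁) : ∀ x : DihedralGroup m, x ∈ T ↔ r h * x ∉ T
  | r k => by rw [r_mul_r, hTr, hTr]; exact hS k
  | sr k => by
      rw [r_mul_sr, hTs, hTs, show t - (k - h) = h + (t - k) by ring]
      exact hS (t - k)

/-- **The companion set is moved by `c₀`**: some `x ∈ D` has `r h · x ∉ D`. [folklore] -/
theorem comirror_moved [NeZero m] (hS : ∀ k, k ∈ S₁ ↔ h + k ∉ S₁) (hDr : ∀ k, r k ∈ D ↔ k ∈ S₁) :
    ∃ x ∈ D, r h * x ∉ D := by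
  have hne : S₁.Nonempty := by
    by_contra h0
    rw [Finset.not_nonempty_iff_eq_empty] at h0
    have := (hS 0).2 (by rw [h0]; exact Finset.notMem_empty _)
    rw [h0] at this
    exact Finset.notMem_empty _ this
  obtain ⟨k₀, hk₀⟩ := hne
  exact ⟨r k₀, (hDr k₀).2 hk₀, by rw [r_mul_r, hDr]; exact (hS k₀).1 hk₀⟩

/-- **THE BALANCED SET.**  `2 · #{x ∈ D : x g ∈ T} = #D` for every `g`: on each sheet the count is an autocorrelation
of `S₁` or its complement to `#S₁`, and the two sheets are exchanged by `a(j) = a(−j)`. [cite: Gordon1999HodgeAVSurvey, §9.3] -/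
theorem mirror_balanced [NeZero m] (hS : ∀ k, k ∈ S₁ ↔ h + k ∉ S₁) (hTr : ∀ k, r k ∈ T ↔ k ∈ S₁)
    (hTs : ∀ k, sr k ∈ T ↔ t - k ∈ S₁) (hDr : ∀ k, r k ∈ D ↔ k ∈ S₁) (hDs : ∀ k, sr k ∈ D ↔ t - k ∉ S₁)
    (g : DihedralGroup m) : 2 * (D.filter fun x => x * g ∈ T).card = D.card := by
  classical
  have hcard := two_mul_card_of_half S₁ h hS
  -- `#D = m`
  have hD : D.card = m := by
    have h1 : D = Finset.univ.filter fun x => x ∈ D := by simp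
    rw [h1, card_filter_dihedral]
    simp only [hDr, hDs, Finset.filter_univ_mem]
    rw [card_filter_sub_left (fun u => u ∉ S₁) t]
    have h2 : (Finset.univ.filter fun u : ZMod m => u ∉ S₁) = S₁ᶜ := by ext; simp
    rw [h2, Finset.card_compl, ZMod.card]
    have h3 : S₁.card ≤ Fintype.card (ZMod m) := Finset.card_le_univ S₁
    rw [ZMod.card] at h3
    omega
  have hfilter : (D.filter fun x => x * g ∈ T) = Finset.univ.filter fun x => x ∈ D ∧ x * g ∈ T := by
    ext x; simp
  rw [hD, hfilter, card_filter_dihedral]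
  rcases g with j | j
  · -- `g = r j`
    simp only [r_mul_r, sr_mul_r, hDr, hDs, hTr, hTs]
    have h2 : (Finset.univ.filter fun k : ZMod m => t - k ∉ S₁ ∧ t - (k + j) ∈ S₁).card =
        (Finset.univ.filter fun u : ZMod m => u ∉ S₁ ∧ u + -j ∈ S₁).card := by
      rw [← card_filter_sub_left (fun u => u ∉ S₁ ∧ u + -j ∈ S₁) t]
      congr 1
      refine Finset.filter_congr fun k _ => ?_
      rw [show t - (k + j) = t - k + -j by ring]
    have h3 := card_filter_not_mem_add S₁ (-j)
    have h4 := card_autocorrelation_symm S₁ j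
    simp only [← sub_eq_add_neg] at h3 h4 h2
    omega
  · -- `g = sr j`
    simp only [r_mul_sr, sr_mul_sr, hDr, hDs, hTr, hTs]
    have h1 : (Finset.univ.filter fun k : ZMod m => k ∈ S₁ ∧ t - (j - k) ∈ S₁).card =
        (Finset.univ.filter fun k : ZMod m => k ∈ S₁ ∧ k + (t - j) ∈ S₁).card := by
      congr 1
      refine Finset.filter_congr fun k _ => ?_
      rw [show t - (j - k) = k + (t - j) by ring]
    have h2 : (Finset.univ.filter fun k : ZMod m => t - k ∉ S₁ ∧ j - k ∈ S₁).card =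
        (Finset.univ.filter fun u : ZMod m => u ∉ S₁ ∧ u + (j - t) ∈ S₁).card := by
      rw [← card_filter_sub_left (fun u => u ∉ S₁ ∧ u + (j - t) ∈ S₁) t]
      congr 1
      refine Finset.filter_congr fun k _ => ?_
      rw [show t - k + (j - t) = j - k by ring]
    have h3 := card_filter_not_mem_add S₁ (j - t)
    have h4 := card_autocorrelation_symm S₁ (j - t)
    have h5 : (Finset.univ.filter fun k : ZMod m => k ∈ S₁ ∧ k - (j - t) ∈ S₁).card =
        (Finset.univ.filter fun k : ZMod m => k ∈ S₁ ∧ k + (t - j) ∈ S₁).card := by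
      congr 1
      refine Finset.filter_congr fun k _ => ?_
      rw [show k - (j - t) = k + (t - j) by ring]
    omega

/-! ## §3 The left stabiliser -/

/-- **Trivial left stabiliser** of the mirror type when `S₁` is aperiodic (no `r j`, `j ≠ 0`, stabilises) and
asymmetric (no `sr j` stabilises: it would give `S₁ = (t - j) - S₁`). [cite: Shimura1998, §8.2 Prop. 26] -/
theorem mirror_leftStabiliser (haper : ∀ j : ZMod m, j ≠ 0 → ∃ k, ¬ (k ∈ S₁ ↔ j + k ∈ S₁))
    (hasym : ∀ u : ZMod m, ∃ k, ¬ (k ∈ S₁ ↔ u - k ∈ S₁)) (hTr : ∀ k, r k ∈ T ↔ k ∈ S₁)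
    (hTs : ∀ k, sr k ∈ T ↔ t - k ∈ S₁) :
    ∀ v : DihedralGroup m, v ≠ 1 → ∃ w : DihedralGroup m, ¬ (w ∈ T ↔ v * w ∈ T)
  | r j, hv => by
      have hj : j ≠ 0 := fun hj => hv (by rw [hj, r_zero])
      obtain ⟨k, hk⟩ := haper j hj
      exact ⟨r k, by rwa [r_mul_r, hTr, hTr]⟩
  | sr j, _ => by
      obtain ⟨k, hk⟩ := hasym (t - j)
      exact ⟨r k, by rwa [sr_mul_r, hTr, hTs, show t - (j + k) = t - j - k by ring]⟩

end Mirror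

/-! ## §4 Field level: a primitive degenerate CM type, a simple degenerate CM abelian variety -/

section Field

variable {K : Type} [Field K] [NumberField K] [IsCMField K] [IsGalois ℚ K]
variable {m : ℕ} [NeZero m]

/-- **Mirror types are PRIMITIVE and DEGENERATE.**  `e : Gal(K/ℚ) ≃* DihedralGroup m` with `e(c) = r h`; `S₁` an
aperiodic asymmetric CM half of `ℤ/m` for `h`; then `K` has a primitive CM type which is not nondegenerate.
[cite: Shimura1998, §8.2 Prop. 26] [cite: Gordon1999HodgeAVSurvey, §9.3] [cite: Kubota1965, §2] -/
theorem exists_isPrimitive_not_isNondegenerate_of_mirror (e : (K ≃ₐ[ℚ] K) ≃* DihedralGroup m) (h : ZMod m)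
    (hc : e ((IsCMField.complexConj K).restrictScalars ℚ) = r h) (S₁ : Finset (ZMod m)) (t : ZMod m)
    (hS : ∀ k, k ∈ S₁ ↔ h + k ∉ S₁) (haper : ∀ j : ZMod m, j ≠ 0 → ∃ k, ¬ (k ∈ S₁ ↔ j + k ∈ S₁))
    (hasym : ∀ u : ZMod m, ∃ k, ¬ (k ∈ S₁ ↔ u - k ∈ S₁)) (φ₀ : K →+* ℂ) :
    ∃ Φ : CMType K, IsPrimitive (ℂ ≃+* ℂ) Φ.1 φ₀ ∧ ¬ IsNondegenerate Φ := by
  classical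
  obtain ⟨T, hTr, hTs⟩ := exists_mirror S₁ t
  obtain ⟨D, hDr, hDs⟩ := exists_comirror S₁ t
  exact exists_isPrimitive_not_isNondegenerate_of_model_balanced e (r h) hc T (mirror_mem_iff hS hTr hTs)
    (mirror_leftStabiliser haper hasym hTr hTs) D (mirror_balanced hS hTr hTs hDr hDs) (comirror_moved hS hDr) φ₀

/-- **… realised: a SIMPLE DEGENERATE abelian variety of dimension `m` with CM by `K`**, carrying on some power a
rational `(p,p)` class outside the complexified divisor ring. [cite: Shimura1998, §6.2 Thm. 3 and §8.2 Prop. 26]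
[cite: Gordon1999HodgeAVSurvey, Thm. 6.4] -/
theorem exists_simple_degenerate_of_mirror (e : (K ≃ₐ[ℚ] K) ≃* DihedralGroup m) (h : ZMod m)
    (hc : e ((IsCMField.complexConj K).restrictScalars ℚ) = r h) (S₁ : Finset (ZMod m)) (t : ZMod m)
    (hS : ∀ k, k ∈ S₁ ↔ h + k ∉ S₁) (haper : ∀ j : ZMod m, j ≠ 0 → ∃ k, ¬ (k ∈ S₁ ↔ j + k ∈ S₁))
    (hasym : ∀ u : ZMod m, ∃ k, ¬ (k ∈ S₁ ↔ u - k ∈ S₁)) :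
    ∃ (Φ : CMType K) (φ₀ : K →+* ℂ) (A : AbelianVariety ℂ) (ι : 𝓞 K →+* End A)
      (θ : K →+* Module.End ℂ (complexBetti A.X 1)),
      IsPrimitive (ℂ ≃+* ℂ) Φ.1 φ₀ ∧ ¬ IsNondegenerate Φ ∧ IsCMTypeRealisation Φ A ι θ ∧ A.IsSimple ∧
      A.dim = m ∧
      ∃ n p : ℕ, ∃ x : complexBetti (⨁ fun _ : Fin n => A).X (2 * p), IsRationalClass x ∧
        IsOfHodgeType (⨁ fun _ : Fin n => A).dim (⨁ fun _ : Fin n => A).X (2 * p) p p x ∧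
        x ∉ divisorClassesSpan (⨁ fun _ : Fin n => A).X (⨁ fun _ : Fin n => A).dim p := by
  classical
  obtain ⟨T, hTr, hTs⟩ := exists_mirror S₁ t
  obtain ⟨D, hDr, hDs⟩ := exists_comirror S₁ t
  have hmain := exists_simple_degenerate_of_model_balanced e (r h) hc T (mirror_mem_iff hS hTr hTs)
    (mirror_leftStabiliser haper hasym hTr hTs) D (mirror_balanced hS hTr hTs hDr hDs) (comirror_moved hS hDr)
  have hdim : Fintype.card (DihedralGroup m) / 2 = m := by rw [DihedralGroup.card]; omega
  rwa [hdim] at hmain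

end Field

end Summit.HodgeConjecture.CorCM.GaloisDihedral

end
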